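import Summits.ABC.ABC.Theses.DefiniteXi
import Literature.NumberTheory.EllipticCurves.TakahashiDegreeFormula
import Literature.NumberTheory.EllipticCurves.ModularCurveManinSemistableProofs
import Literature.NumberTheory.EllipticCurves.ModularCurveManinSemistableBridgeProofs
import Literature.NumberTheory.EllipticCurves.CuspFormLFunctionLevelConductorProofs
import Literature.NumberTheory.Automorphic.ShimuraCurveRibetTakahashiComponentOrders
import Literature.NumberTheory.EllipticCurves.AnalyticIsogenyDescentProofs
import Literature.NumberTheory.EllipticCurves.IsogenyDegreeLatticeIndexProofs
import Literature.NumberTheory.EllipticCurves.PastenSpectralDegreeIsogenyBoundProofs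
import HarnessLib

/-!
# stub-ideation k1 GEN 13 — `stub_xiDegreeComparison` (crux `SteinbergCore`, stmt-ABC-15024)
# Sketch: helper-lemma SIGNATURES for the plans of `STUB-IDEAS-stub_xiDegreeComparison-1.md`
# (elaboration check only; bodies `sorry` except the one-liners).

PLAN A (one cycle, `C = 163`): child 1 at prime type from `F1 = takahashi2001_thm_2_3_of_coprime`,
`CAR = IsNewformOf.level_eq_conductorNorm` (Carayol), the route item `IsogenyValuationTransport`, and
`FreyModularity` — the Mazur–Kenku item `MazurKenkuBound` of p162272 is REMOVED (pivot = the optimal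
datum `D₀` itself, whose curve has conductor `N` by Carayol).
PLAN B (Kenku-free, `C = 1`): the same with `IsogenyValuationTransport` replaced by the PROVED tree
theorem `PastenShimura2024_lemma_6_8_isogeny_holds` (`c_q(W₀)·b = a·c_q(E)`, `a, b ∣ deg α`) along an
algebraic isogeny `α : W₀ → E` of degree EXACTLY `deg D / δ` (bridge lemma B1/B2 = analytic descent
with kernel count), and the 6-free arithmetic B3.
-/

set_option linter.dupNamespace false

noncomputable section

namespace Summit.ABC.ABC.Cruxes.SteinbergCore.StubIdeasK1G13

open Summit.ABC.ABC.Theses.DefiniteXi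
open Literature.NumberTheory.EllipticCurves Literature.NumberTheory.EllipticCurves.ModularForms
open Literature.NumberTheory.Automorphic
open WeierstrassCurve

/-- The target: child 1 at PRIME TYPE = the binder `hC` of
`SteinbergCorePrimeRung.primeRung_of_subs_frey` (p162616) = the conclusion of
`xiDegreeComparison_prime_of_facts` (p137891). -/
def PrimeComparison : Prop :=
  ∀ ε : ℝ, 0 < ε → ∃ C : ℝ, ∀ a b : ℤ, IsCoprime a b → a * b * (a + b) ≠ 0 → ∀ (N : ℕ) [NeZero N],
    (freyCurve a b).conductorNorm ℤ = N → ∀ q : ℕ, q.Prime → q ≠ 2 → q ∣ N →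
    brandtXi (N / q) q (fun n => (freyCurve a b).LFunction n) ≠ 0 →
    ∃ D : ModularParametrizationData (freyCurve a b) N,
      (∀ D' : ModularParametrizationData (freyCurve a b) N, D.deg ≤ D'.deg) ∧
      ((brandtXi (N / q) q (fun n => (freyCurve a b).LFunction n) /
          (ordProj[2] (brandtXi (N / q) q (fun n => (freyCurve a b).LFunction n)) *
            ordProj[3] (brandtXi (N / q) q (fun n => (freyCurve a b).LFunction n))) : ℕ) : ℝ) ≤
        C * (N : ℝ) ^ ε * ((D.deg / (ordProj[2] D.deg * ordProj[3] D.deg) : ℕ) : ℝ) *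
          ((∏ p ∈ N.primeFactors, ((freyCurve a b).minimalDiscriminantNorm ℤ).factorization p : ℕ) : ℝ) ^ 3

/- `PrimeComparison` is verbatim the conclusion of `Summit.ABC.ABC.Theorems.xiDegreeComparison_prime_of_facts`
(p137891) and the binder `hC` of `SteinbergCorePrimeRung.primeRung_of_subs_frey` (p162616); this light Sketch does not
import those Summit modules (farm snapshot), the memo records the check. -/

/-! ## PLAN A helpers -/

/-- **A1.** Carayol's level theorem pins the conductor of the curve of ANY datum at level `N`
(in particular of the lattice-optimal `W₀` of `exists_optimalDatum'`). One line. -/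
theorem conductorNorm_eq_level_of_datum
    (hCar : ∀ (N : ℕ) [NeZero N], IsNewformOf.level_eq_conductorNorm (N := N))
    {N : ℕ} [NeZero N] {W₀ : WeierstrassCurve ℚ} [W₀.IsElliptic]
    (D₀ : ModularParametrizationData W₀ N) : W₀.conductorNorm ℤ = N :=
  (hCar N D₀.isNewformOf).symm

/-- **A1'.** The same from MODULARITY of every elliptic curve (`exists_isNewformOf`, B–C–D–T) instead of
Carayol, by strong multiplicity one across levels (tree theorem
`IsNewformOf.level_eq_conductorNorm_of_exists_isNewformOf'`). -/
theorem conductorNorm_eq_level_of_datum' (h₁ : exists_isNewformOf)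
    {N : ℕ} [NeZero N] {W₀ : WeierstrassCurve ℚ} [W₀.IsElliptic]
    (D₀ : ModularParametrizationData W₀ N) : W₀.conductorNorm ℤ = N :=
  (IsNewformOf.level_eq_conductorNorm_of_exists_isNewformOf' (N := N) h₁ D₀.isNewformOf).symm

/-- **A2.** A lattice-optimal datum is minimal among ALL data with its newform, hence satisfies the
conductor-restricted minimality clause of `takahashi2001_thm_2_3_of_coprime` verbatim. One line over
`modularDegree_le_of_isogenyMap_ker_eq_bot`. -/
theorem conductorRestrictedMinimal_of_optimal {N : ℕ} [NeZero N] {W₀ : WeierstrassCurve ℚ}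
    [W₀.IsElliptic] (D₀ : ModularParametrizationData W₀ N)
    (h₀ : ∀ z ∈ D₀.L.lattice, ∃ w ∈ periodLattice D₀.f, z = D₀.c * w) :
    ∀ (W' : WeierstrassCurve ℚ) [W'.IsElliptic], W'.conductorNorm ℤ = N →
      ∀ P' : ModularParametrizationData W' N, P'.f = D₀.f →
        D₀.modularDegree ≤ P'.modularDegree :=
  fun _ _ _ P' hP' =>
    D₀.modularDegree_le_of_isogenyMap_ker_eq_bot (D₀.isogenyMap_ker_eq_bot_iff.mpr h₀) P' hP'

/-- **A3.** The `cps` chain with the optimal pivot (`m⋆ = 1`): from `δ₀ i = ξ j` (`j ≠ 0`),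
`deg D = δ₀ m_E` (`m_E ≠ 0`) and `i ≤ 163 T`: `cps ξ ≤ 4·163² · cps (deg D) · T` — literally
`primeToSix_chain` at `P := δ₀`, `ms := 1` (zero work; a sharper `163` needs five more lines). -/
theorem primeToSix_chain_optimal {ξ j δ₀ mE d i T : ℕ} (hδ : δ₀ * i = ξ * j) (hj : j ≠ 0)
    (hd : d = δ₀ * mE) (hmE0 : mE ≠ 0) (hi : i ≤ 163 * T) :
    ξ / (ordProj[2] ξ * ordProj[3] ξ) ≤ 4 * 163 * 163 * (d / (ordProj[2] d * ordProj[3] d)) * T := by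
  -- = `XiDegreeComparisonPrime.primeToSix_chain hδ hj (mul_one δ₀).symm hd hmE0 (by norm_num) hi` (p137891;
  --    not imported in this light Sketch)
  sorry

/-- **A4 (PLAN A, the one-cycle target).** Child 1 at prime type from Takahashi 2.3, Carayol, the
route item `IsogenyValuationTransport` and `FreyModularity` — NO `MazurKenkuBound`.  Proof = p137891's
`xiDegreeComparison_prime_of_facts` with the pivot `(W⋆, P⋆) := (W₀, D₀)` (`exists_optimalDatum'`; conductor by
A1, minimality by A2), the block `m_E ≤ 4·163` deleted (`m⋆ = 1`, A3), `stub_valTransport` fed with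
`isogenyValuationTransport_iff.mp hIVT`. -/
theorem primeComparison_of_carayol (hT : takahashi2001_thm_2_3_of_coprime)
    (hCar : ∀ (N : ℕ) [NeZero N], IsNewformOf.level_eq_conductorNorm (N := N))
    (hIVT : IsogenyValuationTransport) (hMod : FreyModularity) : PrimeComparison := by
  sorry

/-! ## PLAN B helpers (Kenku-free, `C = 1`) -/

/-- The Kenku-free Lemma 6.8 is a THEOREM of the tree (no hypothesis). -/
example : PastenShimura2024_lemma_6_8_isogeny := PastenShimura2024_lemma_6_8_isogeny_holds

/-- **B1 (the bridge: analytic descent WITH kernel count).** `isIsogenous_of_forall_mul_mem_lattice`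
(Silverman AEC VI.4.1(b)/VI.5.3 with descent to `ℚ`) remembers only that an isogeny exists; the same
construction (`Φ(u₁ z) = u₂(c z)`, `hfφ : j ∘ φ = Φ ∘ j`) with `PeriodPair.card_ker_eq_relIndex_of_apply_eq`
(all torsion of `E(ℂ)` is `ℚ̄`-rational, Step 3 of `degree_eq_natCard_ker_mulQuotientMap_of_baseChange_eq_curve`)
gives an isogeny of degree `#ker(z ↦ cz) = [Λ₂ : cΛ₁]`.  Stated for short models (`W.baseChange ℂ = L.curve`,
as the tree's converse `degree_eq_natCard_ker_mulQuotientMap_of_baseChange_eq_curve`). -/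
theorem exists_isogeny_degree_eq_natCard_ker {W₁ W₂ : WeierstrassCurve ℚ} [W₁.IsElliptic]
    [W₂.IsElliptic] {L₁ L₂ : PeriodPair} (hW₁ : W₁.baseChange ℂ = L₁.curve)
    (hW₂ : W₂.baseChange ℂ = L₂.curve) {c : ℚ} (hc : c ≠ 0)
    (hle : ∀ z ∈ L₁.lattice, (c : ℂ) * z ∈ L₂.lattice) :
    ∃ φ : Isogeny W₁ W₂, φ.degree =
      Nat.card (mulQuotientMap L₁.lattice.toAddSubgroup L₂.lattice.toAddSubgroup (c : ℂ) hle).ker := by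
  sorry

/-- **B2 (data form of the bridge).** For a datum `D` of `W` and the lattice-optimal datum `D₀` of `W₀`
with the same newform there is a `ℚ`-isogeny `α : W₀ → W` with `deg D = deg α · deg D₀` — the degree formula
`modularDegree_eq_card_ker_mul_of_eichlerShimuraMap` for `D` and `D₀` (same `d₀` from
`exists_degree_eichlerShimuraMap'`; `#ker = 1` for `D₀`) and B1 at `c := D.c / D₀.c` through the short
models (`shortModel_baseChange_eq_curve`, `toIsogeny`, `Isogeny.comp`; degrees of isomorphisms are `1`). -/
theorem exists_isogeny_modularDegree_eq {N : ℕ} [NeZero N] {W W₀ : WeierstrassCurve ℚ} [W.IsElliptic]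
    [W₀.IsElliptic] (D : ModularParametrizationData W N) (D₀ : ModularParametrizationData W₀ N)
    (hf : D₀.f = D.f) (h₀ : ∀ z ∈ D₀.L.lattice, ∃ w ∈ periodLattice D₀.f, z = D₀.c * w) :
    ∃ α : Isogeny W₀ W, D.modularDegree = α.degree * D₀.modularDegree := by
  sorry

/-- **B3 (6-free arithmetic).** From `ξ j² b = δ a c` with `j, b ≥ 1` and `a ∣ m`, `m ≥ 1`:
`cps ξ ≤ cps (δ m) · c` (`cps` multiplicative, `cps a ∣ cps m`, `cps c ≤ c`). -/
theorem primeToSix_le_of_sq_chain {ξ j b δ a c m : ℕ} (h : ξ * j * j * b = δ * a * c)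
    (hj : 0 < j) (hb : 0 < b) (ham : a ∣ m) (hm : 0 < m) :
    ξ / (ordProj[2] ξ * ordProj[3] ξ) ≤ δ * m / (ordProj[2] (δ * m) * ordProj[3] (δ * m)) * c := by
  sorry

/-- **B4 (PLAN B target).** Child 1 at prime type with `C = 1` from Takahashi 2.3 + Carayol (+ `FreyModularity`):
`D` minimal for `E = freyCurve a b` (`FreyModularity`, `exists_minimal_datum`); `(W₀, D₀)` optimal
(`exists_optimalDatum'`), `N_{W₀} = N = Mq` (A1), `δ := deg D₀`, `deg D = m · δ` with `α : W₀ → E` of degree `m`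
(B2); Takahashi at `(W₀, D₀, S)` (A2): `δ i = ξ j`, `i j = c_q(W₀)`, so `ξ j² = δ c_q(W₀)`; `E` and `W₀`
multiplicative at `v_q` (`hasMultiplicativeReductionAt_primesEquiv_symm_of_dvd_of_not_sq_dvd`, `M.Coprime q`;
`hasMultiplicativeReductionAt_of_isIsogenous`); `exists_ordMinimalDiscriminant_mul_eq_mul_of_degree_eq`
(`c_q(W₀) b = c_q(E) a`, `a b ∣ m`) with `factorization_minimalDiscriminantNorm_holds`; B3 gives
`cps ξ ≤ cps (deg D) · c_q(E) ≤ cps (deg D) · T`; then `N^ε ≥ 1`, `T ≤ T³`. -/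
theorem primeComparison_kenkuFree (hT : takahashi2001_thm_2_3_of_coprime)
    (hCar : ∀ (N : ℕ) [NeZero N], IsNewformOf.level_eq_conductorNorm (N := N))
    (hMod : FreyModularity) : PrimeComparison := by
  sorry

/-! ## Typing checks of the tree inputs used above (no new facts) -/

example : ∀ {W W' : WeierstrassCurve ℚ} [W.IsElliptic] [W'.IsElliptic] (φ : Isogeny W W')
    (v : IsDedekindDomain.HeightOneSpectrum ℤ), W.HasMultiplicativeReductionAt v →
      W'.HasMultiplicativeReductionAt v →
        ∃ a b : ℕ, 0 < a ∧ 0 < b ∧ a * b ∣ φ.degree ∧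
          W.ordMinimalDiscriminant v * b = W'.ordMinimalDiscriminant v * a :=
  fun φ v hv hv' => exists_ordMinimalDiscriminant_mul_eq_mul_of_degree_eq φ.degree φ rfl v hv hv'

example (W : WeierstrassCurve ℚ) [W.IsElliptic] {p : ℕ} (hp : p.Prime)
    (hpN : p ∣ W.conductorNorm ℤ) (hp2 : ¬ p ^ 2 ∣ W.conductorNorm ℤ) :
    W.HasMultiplicativeReductionAt ((Rat.HeightOneSpectrum.primesEquiv (R := ℤ)).symm ⟨p, hp⟩) :=
  hasMultiplicativeReductionAt_primesEquiv_symm_of_dvd_of_not_sq_dvd W hp hpN hp2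

end Summit.ABC.ABC.Cruxes.SteinbergCore.StubIdeasK1G13

end
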